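import Mathlib
import Summits.Ventures.PercRepro2.HCov
import Summits.Ventures.PercRepro2.HCovSwap
import Summits.Ventures.PercRepro2.ContractDefs
import Summits.Ventures.PercRepro2.HCovCubic
import Summits.Ventures.PercRepro2.RECMReduction
import Summits.Ventures.PercRepro2.RECMReductionC
import Summits.Ventures.PercRepro2.GcTransport

/-!
# The typed bridge (c-CW) ⟹ (HCOV) ⟹ (c-RECM): the root-edge reduction with deletion AND
contraction (blind cell PercRepro2, p1 g11; lead g19 ASSIGNMENTS v12.12 (b) – v12.17 (c))

At an unmarked-`y` root edge `e = {a₁, y}` with weight `t = p e` (`GcTransport.lean`):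

  `Gc(G) = (1 − t)³ · Gc(G − e) + T₁ + T₂ + t³ · Gc(G/e)`

(`Gc_split_edge`, `Gc_update_zero_eq_loop`, `Gc_update_one_eq_contract`), `T_j` the three-copy
sums with exactly `j` copies open at `e`.

**(c-CW)** in weighted form (row (c-CW), LEAD-CCW.md §2: `N_{(k′,j)} ≥ c · N_{(k′,3)}`, `j = 1, 2`,
summed against the Bernstein weights of the other edges): **`cCWAt c … e y`**:
`c · t^j (1 − t)^{3−j} · Gc(G/e) ≤ T_j` for `j = 1, 2`; **`cCW_all c`**: at every unmarked-`y` root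
edge of every finite graph.

* **`HCov_all_of_cCW_all`**: `0 ≤ c → cCW_all c → HCovR_all → HCov_all` — strong induction on
  `nonLoopCard`: at a root edge to an unmarked vertex the deletion and the contraction are
  nonnegative by the induction hypothesis and the two mixed terms by (c-CW) (any `c ≥ 0` closes
  the induction, as LEAD-CCW §2 says); a root edge at `a₂` is handled through `Gc_swap`; otherwise
  the graph is in class R.
* **`cRECM_all_of_cCW_all`**: `0 ≤ c → cCW_all c → HCovR_all → cRECM_all (c − c²/4)` — the
  «(c-CW) ⟹ (c-RECM)» half of the chain: (c-CW) alone does NOT give (c-RECM) (the deletion term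
  `(1 − t)³ Gc(G − e)` has to be nonnegative), but once (HCOV) is known for every graph,
  `Gc(G) ≥ t · Gc(G/e) · (c (1 − t) + t²) ≥ (c − c²/4) · t · Gc(G/e)` since
  `c (1 − t) + t² − (c − c²/4) = (t − c/2)²` (`cRECMAt_of_cCWAt`). With `HCov_all_of_cRECM_all`
  (RECMReductionC) this closes the loop (HCOV) ⟺ (c-RECM) ∧ (HCOV on R), modulo (c-CW).
-/

namespace Summit.Ventures.PercRepro2

open CovForm Contract

namespace RECM

/-! ## (c-CW) in weighted form and the reduction -/

section Defs

variable {V : Type*} {E : Type*} [Fintype E] [DecidableEq E] [DecidableEq V] {R : Type*}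
  [Field R] [LinearOrder R] [IsStrictOrderedRing R]

/-- **(c-CW) at the root edge `e = {a₁, y}`, weighted form** (row (c-CW), LEAD-CCW §2): for
`j = 1, 2` the three-copy sum `T_j` over the triples with exactly `j` copies open at `e` dominates
`c · t^j (1 − t)^{3−j} · Gc(G/e)`, `t = p e` — the typed inequalities `N_{(k′,j)} ≥ c · N_{(k′,3)}`
summed against the Bernstein weights of the other edges. -/
def cCWAt (c : R) (p : E → R) (ends : E → Sym2 V) (o a₁ a₂ a₃ b : V) (e : E) (y : V) : Prop :=
  ∀ j : ℕ, j = 1 ∨ j = 2 →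
    c * (p e ^ j * (1 - p e) ^ (3 - j) * Gc p (contractRootEdge ends a₁ y) o a₁ a₂ a₃ b) ≤
      triSum p {e} (fun _ => j) (K3 ends o a₁ a₂ a₃ b)

end Defs

section Closure

variable (R : Type*) [Field R] [LinearOrder R] [IsStrictOrderedRing R]

/-- **Row (c-CW), weighted**: (c-CW) with the constant `c` at every root edge `e = {a₁, y}` with
`y` unmarked, on every finite graph with distinct marks and admissible weights. -/
def cCW_all (c : R) : Prop :=
  ∀ (V E : Type) [Fintype V] [DecidableEq V] [Fintype E] [DecidableEq E]
    (ends : E → Sym2 V) (p : E → R), IsProbVec p →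
    ∀ o a₁ a₂ a₃ b : V, a₁ ≠ a₂ → a₁ ≠ a₃ → a₂ ≠ a₃ → o ≠ a₁ → o ≠ a₂ → o ≠ a₃ → o ≠ b →
      b ≠ a₁ → b ≠ a₂ → b ≠ a₃ → ∀ (y : V) (e : E), Unmarked o a₁ a₂ a₃ b y → ends e = s(a₁, y) →
        cCWAt c p ends o a₁ a₂ a₃ b e y

end Closure

section Split

variable {V : Type*} {E : Type*} [Fintype E] [DecidableEq E] [DecidableEq V] {R : Type*}
  [Field R] [LinearOrder R] [IsStrictOrderedRing R]

omit [DecidableEq V] [LinearOrder R] [IsStrictOrderedRing R] in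
/-- The typed sum only sees the types on `F`. -/
lemma triSum_congr_types (p : E → R) (F : Finset E) {τ τ' : E → ℕ} (h : ∀ e ∈ F, τ e = τ' e)
    (K : Config E → Config E → Config E → R) : triSum p F τ K = triSum p F τ' K := by
  unfold triSum
  refine Finset.sum_congr rfl fun x _ => Finset.sum_congr rfl fun y _ =>
    Finset.sum_congr rfl fun z _ => ?_
  exact if_congr (forall₂_congr fun e he => by rw [h e he]) rfl rfl

omit [DecidableEq V] in
/-- **The Bernstein split of `Gc` at the edge `e`**:
`Gc = (1 − t)³ · Gc(p[e ↦ 0]) + t³ · Gc(p[e ↦ 1]) + T₁ + T₂`. -/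
theorem Gc_split_edge (p : E → R) (ends : E → Sym2 V) (o a₁ a₂ a₃ b : V) (e : E) :
    Gc p ends o a₁ a₂ a₃ b =
      (1 - p e) ^ 3 * Gc (Function.update p e 0) ends o a₁ a₂ a₃ b +
        p e ^ 3 * Gc (Function.update p e 1) ends o a₁ a₂ a₃ b +
        triSum p {e} (fun _ => 1) (K3 ends o a₁ a₂ a₃ b) +
        triSum p {e} (fun _ => 2) (K3 ends o a₁ a₂ a₃ b) := by
  rw [hcov_cubic p ends o a₁ a₂ a₃ b (fun _ => 0),
    triSum_pin p (Finset.notMem_empty e) (fun _ => 0) (K3 ends o a₁ a₂ a₃ b),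
    ← hcov_cubic (Function.update p e 0) ends o a₁ a₂ a₃ b (fun _ => 0),
    ← hcov_cubic (Function.update p e 1) ends o a₁ a₂ a₃ b (fun _ => 0), Finset.insert_empty,
    triSum_congr_types p {e} (τ := Function.update (fun _ => 0) e 1) (τ' := fun _ => 1)
      (fun f hf => by rw [Finset.mem_singleton.mp hf, Function.update_self]),
    triSum_congr_types p {e} (τ := Function.update (fun _ => 0) e 2) (τ' := fun _ => 2)
      (fun f hf => by rw [Finset.mem_singleton.mp hf, Function.update_self])]

/-- **(HCOV) at a graph with a root edge `e = {a₁, y}` to an unmarked `y`** from (c-CW) at `e`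
and (HCOV) for the deletion and the contraction of `e`. -/
theorem HCov_of_cCWAt {c : R} (hc : 0 ≤ c) (p : E → R) (hp : IsProbVec p) {ends : E → Sym2 V}
    {e : E} {o a₁ a₂ a₃ b y : V} (hg : ends e = s(a₁, y)) (hy : Unmarked o a₁ a₂ a₃ b y)
    (ho1 : o ≠ a₁) (h12 : a₁ ≠ a₂) (h13 : a₁ ≠ a₃) (hb1 : b ≠ a₁)
    (hCW : cCWAt c p ends o a₁ a₂ a₃ b e y)
    (hdel : HCov p (Function.update ends e s(y, y)) o a₁ a₂ a₃ b)
    (hcon : HCov p (contractRootEdge ends a₁ y) o a₁ a₂ a₃ b) : HCov p ends o a₁ a₂ a₃ b := by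
  unfold HCov at hdel hcon ⊢
  rw [Gc_split_edge p ends o a₁ a₂ a₃ b e, ← Gc_update_zero_eq_loop p ends e y] at *
  rw [Gc_update_one_eq_contract p hg hy ho1 h12 h13 hb1]
  have h0 : 0 ≤ (1 - p e) ^ 3 := pow_nonneg (sub_nonneg.mpr (hp.le_one e)) 3
  have h1 : 0 ≤ p e ^ 3 := pow_nonneg (hp.nonneg e) 3
  have hT1 := hCW 1 (Or.inl rfl)
  have hT2 := hCW 2 (Or.inr rfl)
  have hw1 : 0 ≤ p e ^ 1 * (1 - p e) ^ (3 - 1) :=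
    mul_nonneg (pow_nonneg (hp.nonneg e) _) (pow_nonneg (sub_nonneg.mpr (hp.le_one e)) _)
  have hw2 : 0 ≤ p e ^ 2 * (1 - p e) ^ (3 - 2) :=
    mul_nonneg (pow_nonneg (hp.nonneg e) _) (pow_nonneg (sub_nonneg.mpr (hp.le_one e)) _)
  have hT1' : 0 ≤ triSum p {e} (fun _ => 1) (K3 ends o a₁ a₂ a₃ b) :=
    le_trans (mul_nonneg hc (mul_nonneg hw1 hcon)) hT1
  have hT2' : 0 ≤ triSum p {e} (fun _ => 2) (K3 ends o a₁ a₂ a₃ b) :=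
    le_trans (mul_nonneg hc (mul_nonneg hw2 hcon)) hT2
  have := mul_nonneg h0 hdel
  have := mul_nonneg h1 hcon
  linarith

end Split

section Main

variable {R : Type*} [Field R] [LinearOrder R] [IsStrictOrderedRing R]

/-- **The reduction with deletion and contraction**, by strong induction on the number of non-loop
edges: (HCOV) for every graph on the types `V, E` from (c-CW) at unmarked-`y` root edges (`0 ≤ c`)
and (HCOV) on class R. At a root edge to an unmarked vertex the deletion (`e` re-routed to a loop)
and the contraction are nonnegative by the induction hypothesis and the two mixed Bernstein terms
by (c-CW); a root edge at `a₂` is handled through `Gc_swap`; otherwise the graph is in class R. -/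
theorem HCov_of_cCW_of_base {V E : Type} [Fintype V] [DecidableEq V] [Fintype E] [DecidableEq E]
    {c : R} (hc : 0 ≤ c) (hCW : cCW_all R c) (hB : HCovR_all R) (n : ℕ) :
    ∀ (ends : E → Sym2 V), nonLoopCard ends = n → ∀ (p : E → R), IsProbVec p →
      ∀ o a₁ a₂ a₃ b : V, a₁ ≠ a₂ → a₁ ≠ a₃ → a₂ ≠ a₃ → o ≠ a₁ → o ≠ a₂ → o ≠ a₃ → o ≠ b →
        b ≠ a₁ → b ≠ a₂ → b ≠ a₃ → HCov p ends o a₁ a₂ a₃ b := by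
  induction n using Nat.strong_induction_on with
  | _ n ih =>
  intro ends hn p hp o a₁ a₂ a₃ b h12 h13 h23 ho1 ho2 ho3 hob hb1 hb2 hb3
  by_cases h1 : ∃ (e : E) (y : V), Unmarked o a₁ a₂ a₃ b y ∧ ends e = s(a₁, y)
  · -- a root edge at `a₁` reaches an unmarked vertex: delete and contract it
    obtain ⟨e, y, hy, he⟩ := h1
    have hcw := hCW V E ends p hp o a₁ a₂ a₃ b h12 h13 h23 ho1 ho2 ho3 hob hb1 hb2 hb3 y e hy he
    have hne : ¬ (ends e).IsDiag := by
      rw [he, Sym2.mk_isDiag_iff]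
      exact hy.2.1.symm
    have hlt0 : nonLoopCard (Function.update ends e s(y, y)) < n :=
      hn ▸ nonLoopCard_update_loop_lt ends hne y
    have hlt1 : nonLoopCard (contractRootEdge ends a₁ y) < n :=
      hn ▸ nonLoopCard_contract_lt ends hy.2.1.symm he
    exact HCov_of_cCWAt hc p hp he hy ho1 h12 h13 hb1 hcw
      (ih _ hlt0 _ rfl p hp o a₁ a₂ a₃ b h12 h13 h23 ho1 ho2 ho3 hob hb1 hb2 hb3)
      (ih _ hlt1 _ rfl p hp o a₁ a₂ a₃ b h12 h13 h23 ho1 ho2 ho3 hob hb1 hb2 hb3)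
  · by_cases h2 : ∃ (e : E) (y : V), Unmarked o a₁ a₂ a₃ b y ∧ ends e = s(a₂, y)
    · -- a root edge at `a₂` reaches an unmarked vertex: swap the roots
      obtain ⟨e, y, hy, he⟩ := h2
      have hy' : Unmarked o a₂ a₁ a₃ b y := ⟨hy.1, hy.2.2.1, hy.2.1, hy.2.2.2.1, hy.2.2.2.2⟩
      have hcw := hCW V E ends p hp o a₂ a₁ a₃ b h12.symm h23 h13 ho2 ho1 ho3 hob hb2 hb1 hb3 y e
        hy' he
      have hne : ¬ (ends e).IsDiag := by
        rw [he, Sym2.mk_isDiag_iff]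
        exact hy.2.2.1.symm
      have hlt0 : nonLoopCard (Function.update ends e s(y, y)) < n :=
        hn ▸ nonLoopCard_update_loop_lt ends hne y
      have hlt1 : nonLoopCard (contractRootEdge ends a₂ y) < n :=
        hn ▸ nonLoopCard_contract_lt ends hy.2.2.1.symm he
      have key := HCov_of_cCWAt hc p hp he hy' ho2 h12.symm h23 hb2 hcw
        (ih _ hlt0 _ rfl p hp o a₂ a₁ a₃ b h12.symm h23 h13 ho2 ho1 ho3 hob hb2 hb1 hb3)
        (ih _ hlt1 _ rfl p hp o a₂ a₁ a₃ b h12.symm h23 h13 ho2 ho1 ho3 hob hb2 hb1 hb3)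
      unfold HCov at key ⊢
      rwa [Gc_swap] at key
    · -- both roots are adjacent only to marks: class R
      apply hB V E ends p hp o a₁ a₂ a₃ b h12 h13 h23 ho1 ho2 ho3 hob hb1 hb2 hb3
      intro f hroot z hz
      rcases hroot with hf | hf
      · obtain ⟨y, hy⟩ := Sym2.mem_iff_exists.mp hf
        rw [hy] at hz
        rcases Sym2.mem_iff.mp hz with hz1 | hz2
        · rw [hz1]
          simp
        · rw [hz2]
          by_contra hzm
          push Not at hzm
          exact h1 ⟨f, y, hzm, hy⟩
      · obtain ⟨y, hy⟩ := Sym2.mem_iff_exists.mp hf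
        rw [hy] at hz
        rcases Sym2.mem_iff.mp hz with hz1 | hz2
        · rw [hz1]
          simp
        · rw [hz2]
          by_contra hzm
          push Not at hzm
          exact h2 ⟨f, y, hzm, hy⟩

/-- **THE TYPED BRIDGE, WEIGHTED**: `0 ≤ c → cCW_all c → HCovR_all → HCov_all` — (HCOV) for every
finite weighted graph from (c-CW) at unmarked-`y` root edges (one constant `c ≥ 0` for all graphs;
`c = 0` is «the mixed Bernstein terms at root–unmarked edges are nonnegative») together with (HCOV)
on class R. -/
theorem HCov_all_of_cCW_all {c : R} (hc : 0 ≤ c) (hCW : cCW_all R c) (hB : HCovR_all R) :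
    HCov_all R := by
  intro V E _ _ _ _ ends p hp o a₁ a₂ a₃ b h12 h13 h23 ho1 ho2 ho3 hob hb1 hb2 hb3
  exact HCov_of_cCW_of_base hc hCW hB _ ends rfl p hp o a₁ a₂ a₃ b h12 h13 h23 ho1 ho2 ho3 hob
    hb1 hb2 hb3

end Main

/-! ## (c-CW) ⟹ (c-RECM): the weighted shadow with the constant `c − c²/4` -/

section RECMShadow

variable {V : Type*} {E : Type*} [Fintype E] [DecidableEq E] [DecidableEq V] {R : Type*}
  [Field R] [LinearOrder R] [IsStrictOrderedRing R]

/-- **(c-CW) at `e` and (HCOV) of the deletion and of the contraction give (c′-RECM) at `e`** with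
`c′ = c − c²/4`: `Gc(G) ≥ t · Gc(G/e) · (c (1 − t) + t²)` and
`c (1 − t) + t² − (c − c²/4) = (t − c/2)²`. -/
theorem cRECMAt_of_cCWAt {c : R} (p : E → R) (hp : IsProbVec p) {ends : E → Sym2 V} {e : E}
    {o a₁ a₂ a₃ b y : V} (hg : ends e = s(a₁, y)) (hy : Unmarked o a₁ a₂ a₃ b y) (ho1 : o ≠ a₁)
    (h12 : a₁ ≠ a₂) (h13 : a₁ ≠ a₃) (hb1 : b ≠ a₁) (hCW : cCWAt c p ends o a₁ a₂ a₃ b e y)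
    (hdel : HCov p (Function.update ends e s(y, y)) o a₁ a₂ a₃ b)
    (hcon : HCov p (contractRootEdge ends a₁ y) o a₁ a₂ a₃ b) :
    cRECMAt (c - c ^ 2 / 4) p ends o a₁ a₂ a₃ b e y := by
  unfold cRECMAt
  unfold HCov at hdel hcon
  rw [Gc_split_edge p ends o a₁ a₂ a₃ b e, ← Gc_update_zero_eq_loop p ends e y] at *
  rw [Gc_update_one_eq_contract p hg hy ho1 h12 h13 hb1]
  have hT1 := hCW 1 (Or.inl rfl)
  have hT2 := hCW 2 (Or.inr rfl)
  norm_num at hT1 hT2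
  have h0 : 0 ≤ (1 - p e) ^ 3 * Gc (Function.update p e 0) ends o a₁ a₂ a₃ b :=
    mul_nonneg (pow_nonneg (sub_nonneg.mpr (hp.le_one e)) 3) hdel
  have ht : 0 ≤ p e := hp.nonneg e
  have key : (c - c ^ 2 / 4) * (p e * Gc p (contractRootEdge ends a₁ y) o a₁ a₂ a₃ b) ≤
      p e ^ 3 * Gc p (contractRootEdge ends a₁ y) o a₁ a₂ a₃ b +
        c * (p e * (1 - p e) ^ 2 * Gc p (contractRootEdge ends a₁ y) o a₁ a₂ a₃ b) +
        c * (p e ^ 2 * (1 - p e) * Gc p (contractRootEdge ends a₁ y) o a₁ a₂ a₃ b) := by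
    have hsq := mul_nonneg (mul_nonneg ht hcon) (sq_nonneg (p e - c / 2))
    have : p e ^ 3 * Gc p (contractRootEdge ends a₁ y) o a₁ a₂ a₃ b +
        c * (p e * (1 - p e) ^ 2 * Gc p (contractRootEdge ends a₁ y) o a₁ a₂ a₃ b) +
        c * (p e ^ 2 * (1 - p e) * Gc p (contractRootEdge ends a₁ y) o a₁ a₂ a₃ b) -
        (c - c ^ 2 / 4) * (p e * Gc p (contractRootEdge ends a₁ y) o a₁ a₂ a₃ b) =
        p e * Gc p (contractRootEdge ends a₁ y) o a₁ a₂ a₃ b * (p e - c / 2) ^ 2 := by ring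
    linarith
  linarith

/-- **(c-CW) ⟹ (c-RECM)** (the half of the chain asked in ASSIGNMENTS v12.12 (b)): with the
deletion supplied by `HCov_all_of_cCW_all`, (c-CW) on every graph gives (c′-RECM) on every graph,
`c′ = c − c²/4` (`= 5/9` at the census value `c = 2/3`). -/
theorem cRECM_all_of_cCW_all {c : R} (hc : 0 ≤ c) (hCW : cCW_all R c) (hB : HCovR_all R) :
    cRECM_all R (c - c ^ 2 / 4) := by
  have hH := HCov_all_of_cCW_all hc hCW hB
  intro V E _ _ _ _ ends p hp o a₁ a₂ a₃ b h12 h13 h23 ho1 ho2 ho3 hob hb1 hb2 hb3 y e hy he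
  exact cRECMAt_of_cCWAt p hp he hy ho1 h12 h13 hb1
    (hCW V E ends p hp o a₁ a₂ a₃ b h12 h13 h23 ho1 ho2 ho3 hob hb1 hb2 hb3 y e hy he)
    (hH V E _ p hp o a₁ a₂ a₃ b h12 h13 h23 ho1 ho2 ho3 hob hb1 hb2 hb3)
    (hH V E _ p hp o a₁ a₂ a₃ b h12 h13 h23 ho1 ho2 ho3 hob hb1 hb2 hb3)

end RECMShadow

end RECM

end Summit.Ventures.PercRepro2
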